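import Mathlib
import Literature.NumberTheory.Automorphic.GaloisActionPlaces
import HarnessLib

/-!
# An ideal `𝔞` with `𝔞 · c(𝔞) = Q` is pinned by the primes it avoids (the arithmetic skeleton of the Shimura–Taniyama shape)

Topic `Literature/NumberTheory/NumberFields`, namespace `Literature.NumberTheory.NumberFields`.  THEOREMS ONLY (no `def`, no
instance, no named fact), Mathlib + ★ `Automorphic/GaloisActionPlaces` (the action `g • v` of a group of ring automorphisms on
`HeightOneSpectrum B`, `instMulActionHeightOneSpectrum`, and `HeightOneSpectrum.count_smul_asIdeal`: `ord_{g v}(g • I) = ord_v I`).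

## Source (read at the page) and what is recorded

G. Shimura, *Abelian Varieties with Complex Multiplication and Modular Functions* (1998), §13.1 Theorem 1 (pp. 97–99): the prime
ideal decomposition of the `N(𝔓)`-th power Frobenius of the reduction of a CM abelian variety — an integral ideal `𝔞` of the CM
field with `𝔞 𝔞^ρ = (q)` whose prime factors over `p` are prescribed by the CM type.  What is formalised here is the elementary
ARITHMETIC SKELETON of that statement, used downstream to turn a «support law» into the product shape: in a Dedekind domain `B`
with a group `G` acting by ring automorphisms and `c ∈ G`,
* `count_pointwise_smul` — `ord_v (g • I) = ord_{g⁻¹ v} I`;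
* `count_add_count_inv_smul_eq` — THE NORM EQUATION READ PRIME BY PRIME: `𝔞 · (c • 𝔞) = Q` gives
  `ord_v 𝔞 + ord_{c⁻¹ v} 𝔞 = ord_v Q` at every nonzero prime `v`;
* **`count_eq_ite_of_mul_pointwise_smul_eq`** — THE SUPPORT PIN: if moreover `𝔞` avoids a set `E` of primes such that every prime
  `v ⊇ Q` outside `E` has `c⁻¹ v ∈ E`, then `ord_v 𝔞 = 0` on `E` and `ord_v 𝔞 = ord_v Q` off `E`; hence such an `𝔞` is UNIQUE
  (`eq_of_mul_pointwise_smul_eq_of_forall_not_le`) and equals `∏_{v ∉ E} v^{ord_v Q}` (`eq_finprod_of_mul_pointwise_smul_eq`);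
* the CM specialisation (`F` a CM number field, `c = IsCMField.complexConj F`, `Q = (n)`), stated in the token shape
  `Ideal.span {(n : 𝓞 F)} = 𝔞 * (IsCMField.complexConj F) • 𝔞` of the cell՚s `twistNorm_spec` law: `complexConj_inv`,
  `count_add_count_complexConj_smul_eq`, the `w`-block pin `count_eq_count_span_of_not_le_complexConj_smul` («if `c • w ∤ 𝔞` then
  `ord_w 𝔞 = ord_w (n)`»), the full pin `count_eq_ite_of_span_eq_mul_complexConj_smul` and uniqueness
  `eq_of_span_eq_mul_complexConj_smul`; §3 (ED. 2, append-only) the same `w`-block pin in the COPRIMALITY binder shape `𝔞 ⊔ 𝔭_{c•w} = ⊤` of the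
  L3 closer `stub_ROOF0` (`count_eq_count_span_of_sup_complexConj_smul_eq_top` + dvd ∕ exactness ∕ `ord_{c•w} = 0` forms).
The general statements are unique factorisation of ideals in a Dedekind domain — J. S. Milne, *Algebraic Number Theory* (v3.00,
2008), Thm. 3.7 (p. 42) «`𝔞 = 𝔭₁^{r₁}⋯𝔭ₙ^{rₙ}`, the `𝔭ᵢ` and `rᵢ` uniquely determined», Rem. 3.12∕Cor. 3.13 (p. 43) (held text, pages
read) — and the Galois-equivariance of exponents (Cassels–Fröhlich Ch. VII §1.1); the CM reading is the use made of them in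
[Shimura1998, §13.1].  Cell `hodgecm-mathlib` line L3 (socket `stub_FROB`, LEAD «M-54»∕«F-PIN»): the twist ideal `𝔞_γ` of a
Frobenius reading satisfies `(n_γ) = 𝔞_γ · c𝔞_γ`; these lemmas convert the booked support law into the canonical product shape
that the congruence relation reads.  `--supports stmt-HodgeConjecture-24832`, count-neutral.

## Mathlib / tree search

Mathlib: `IsDedekindDomain.HeightOneSpectrum.maxPowDividing`, `Ideal.finprod_heightOneSpectrum_factorization`, `Associates.count_mul`,
`Associates.count_pow`, `Associates.count_ne_zero_iff_dvd`, `Associates.count_le_count_of_le`, `Associates.prime_pow_dvd_iff_le`,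
`Ideal.pointwise_smul_def`, `NumberField.IsCMField.complexConj_apply_apply`; no Mathlib lemma states the norm-equation bookkeeping
or the support pin (`rg "c • 𝔞|pointwise_smul.*count" Mathlib` = 0 relevant hits).  Tree: ★ `GaloisActionPlaces`
(`HeightOneSpectrum.count_smul_asIdeal`, `Ideal.smul_eq_bot_iff`), ★ `CMFieldGaloisPrimesOverSplit` (same currency `c • w`), ★
`IdealExponentsGaloisAction` (`count_smul_coeIdeal`, the `FractionalIdeal.count` currency for `σ : L ≃ₐ[K] L` — not the abstract
`MulSemiringAction` ∕ `Associates.count` currency of the cell՚s laws used here), ★ `GaloisOcticStabiliserLemma.complexConj_mul_self`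
(`c * c = 1`, heavier imports; `complexConj_inv` below is its one-line twin).
-/

namespace Literature.NumberTheory.NumberFields

open NumberField IsDedekindDomain
open scoped Pointwise

/-! ### §1 Valuations of ideals under ring automorphisms; the norm equation `𝔞 · (c • 𝔞) = Q` prime by prime -/

section Dedekind

variable {B : Type*} [CommRing B] [IsDedekindDomain B] {G : Type*} [Group G] [MulSemiringAction G B]

/-- `𝔭_v^k ∣ I ↔ k ≤ ord_v I` for a nonzero ideal `I` of a Dedekind domain (the `Associates.count` currency of
`IsDedekindDomain.HeightOneSpectrum.maxPowDividing`; the exponents `rᵢ` of the unique factorisation). [cite: MilneANT2008, Thm. 3.7 (p. 42)] -/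
theorem pow_dvd_iff_le_count (v : HeightOneSpectrum B) {I : Ideal B} (hI : I ≠ ⊥) (k : ℕ) :
    v.asIdeal ^ k ∣ I ↔ k ≤ (Associates.mk v.asIdeal).count (Associates.mk I).factors := by
  rw [← Associates.mk_le_mk_iff_dvd, Associates.mk_pow,
    Associates.prime_pow_dvd_iff_le (Associates.mk_ne_zero.mpr hI) v.associates_irreducible]

/-- `ord_v I = 0` as soon as `I ⊄ 𝔭_v` («`sᵢ > 0 ⟺ 𝔞 ⊂ 𝔭ᵢ`»). [cite: MilneANT2008, Rem. 3.12 (p. 43)] -/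
theorem count_eq_zero_of_not_le {I : Ideal B} (hI : I ≠ ⊥) {v : HeightOneSpectrum B} (hv : ¬ I ≤ v.asIdeal) :
    (Associates.mk v.asIdeal).count (Associates.mk I).factors = 0 := by
  by_contra hne
  exact hv (Ideal.le_of_dvd ((Associates.count_ne_zero_iff_dvd hI v.irreducible).mp hne))

/-- `ord_v I ≠ 0` as soon as `I ⊆ 𝔭_v` (`I ≠ 0`; «`sᵢ > 0 ⟺ 𝔞 ⊂ 𝔭ᵢ`»). [cite: MilneANT2008, Rem. 3.12 (p. 43)] -/
theorem count_ne_zero_of_le {I : Ideal B} (hI : I ≠ ⊥) {v : HeightOneSpectrum B} (hv : I ≤ v.asIdeal) :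
    (Associates.mk v.asIdeal).count (Associates.mk I).factors ≠ 0 :=
  (Associates.count_ne_zero_iff_dvd hI v.irreducible).mpr (Ideal.dvd_iff_le.mpr hv)

/-- `ord_v I ≤ ord_v J` when `I ∣ J` (`J ≠ 0`): exponents compare under containment∕divisibility. [cite: MilneANT2008, Thm. 3.7 (p. 42)] -/
theorem count_le_count_of_dvd (v : HeightOneSpectrum B) {I J : Ideal B} (hJ : J ≠ ⊥) (h : I ∣ J) :
    (Associates.mk v.asIdeal).count (Associates.mk I).factors ≤
      (Associates.mk v.asIdeal).count (Associates.mk J).factors :=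
  Associates.count_le_count_of_le (Associates.mk_ne_zero.mpr hJ) v.associates_irreducible
    (Associates.mk_le_mk_iff_dvd.mpr h)

/-- Two nonzero ideals of a Dedekind domain with the same exponent at every nonzero prime are equal (unique factorisation,
through `Ideal.finprod_heightOneSpectrum_factorization`; «`𝔞 = 𝔟` iff `𝔞A_𝔭 = 𝔟A_𝔭` for all `𝔭`»). [cite: MilneANT2008, Thm. 3.7 (p. 42), Cor. 3.13 (p. 43)] -/
theorem eq_of_forall_count_eq {I J : Ideal B} (hI : I ≠ ⊥) (hJ : J ≠ ⊥)
    (h : ∀ v : HeightOneSpectrum B,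
      (Associates.mk v.asIdeal).count (Associates.mk I).factors = (Associates.mk v.asIdeal).count (Associates.mk J).factors) :
    I = J := by
  rw [← Ideal.finprod_heightOneSpectrum_factorization hI, ← Ideal.finprod_heightOneSpectrum_factorization hJ]
  exact finprod_congr fun v => by simp only [HeightOneSpectrum.maxPowDividing, h v]

/-- **`ord_v (g • I) = ord_{g⁻¹ v} I`** — the exponent of a prime in a Galois-moved ideal (★ `HeightOneSpectrum.count_smul_asIdeal`
read at `g⁻¹ v`; Cassels–Fröhlich VII §1.1 `|a|_{σ w} = |σ⁻¹ a|_w`). [cite: CasselsFrohlichANT1967, Ch. VII §1.1] -/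
theorem count_pointwise_smul (g : G) (v : HeightOneSpectrum B) {I : Ideal B} (hI : I ≠ ⊥) :
    (Associates.mk v.asIdeal).count (Associates.mk (g • I)).factors =
      (Associates.mk (g⁻¹ • v).asIdeal).count (Associates.mk I).factors := by
  have h := Literature.NumberTheory.Automorphic.HeightOneSpectrum.count_smul_asIdeal g (g⁻¹ • v) hI
  rw [smul_inv_smul] at h
  convert h using 2

omit [IsDedekindDomain B] in
/-- If `𝔞 · (c • 𝔞) = Q ≠ 0` then `𝔞 ≠ 0` (the norm equation `𝔞 𝔞^ρ = (q)`). [cite: Shimura1998, §13.1 Thm. 1 (pp. 97–99)] -/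
theorem ne_bot_of_mul_pointwise_smul_eq (c : G) {𝔞 Q : Ideal B} (hQ : Q ≠ ⊥) (h : 𝔞 * c • 𝔞 = Q) : 𝔞 ≠ ⊥ := by
  rintro rfl
  exact hQ (by rw [← h, Submodule.bot_mul])

omit [IsDedekindDomain B] in
/-- If `𝔞 · (c • 𝔞) = Q` then `𝔞 ∣ Q` (the norm equation `𝔞 𝔞^ρ = (q)`). [cite: Shimura1998, §13.1 Thm. 1 (pp. 97–99)] -/
theorem dvd_of_mul_pointwise_smul_eq (c : G) {𝔞 Q : Ideal B} (h : 𝔞 * c • 𝔞 = Q) : 𝔞 ∣ Q :=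
  ⟨c • 𝔞, h.symm⟩

/-- **THE NORM EQUATION PRIME BY PRIME**: `𝔞 · (c • 𝔞) = Q` gives `ord_v 𝔞 + ord_{c⁻¹ v} 𝔞 = ord_v Q` at every nonzero prime `v`
(`ord_v (c • 𝔞) = ord_{c⁻¹ v} 𝔞`).  With `c` an involution (complex conjugation) this is `ord_v 𝔞 + ord_{c v} 𝔞 = ord_v Q`.
[cite: Shimura1998, §13.1 Thm. 1 (pp. 97–99)] -/
theorem count_add_count_inv_smul_eq (c : G) {𝔞 Q : Ideal B} (hQ : Q ≠ ⊥) (h : 𝔞 * c • 𝔞 = Q) (v : HeightOneSpectrum B) :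
    (Associates.mk v.asIdeal).count (Associates.mk 𝔞).factors +
        (Associates.mk (c⁻¹ • v).asIdeal).count (Associates.mk 𝔞).factors =
      (Associates.mk v.asIdeal).count (Associates.mk Q).factors := by
  have h𝔞 : 𝔞 ≠ ⊥ := ne_bot_of_mul_pointwise_smul_eq c hQ h
  have hc𝔞 : c • 𝔞 ≠ ⊥ := fun h' => h𝔞 ((Literature.NumberTheory.Automorphic.Ideal.smul_eq_bot_iff c 𝔞).mp h')
  rw [← count_pointwise_smul c v h𝔞, ← Associates.count_mul (Associates.mk_ne_zero.mpr h𝔞) (Associates.mk_ne_zero.mpr hc𝔞)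
    v.associates_irreducible, Associates.mk_mul_mk, h]

/-- One half of the norm equation: `ord_v 𝔞 ≤ ord_v Q`. [cite: Shimura1998, §13.1 Thm. 1 (pp. 97–99)] -/
theorem count_le_of_mul_pointwise_smul_eq (c : G) {𝔞 Q : Ideal B} (hQ : Q ≠ ⊥) (h : 𝔞 * c • 𝔞 = Q) (v : HeightOneSpectrum B) :
    (Associates.mk v.asIdeal).count (Associates.mk 𝔞).factors ≤ (Associates.mk v.asIdeal).count (Associates.mk Q).factors :=
  count_le_count_of_dvd v hQ (dvd_of_mul_pointwise_smul_eq c h)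

/-- If `𝔞 · (c • 𝔞) = Q` and `𝔞` avoids `c⁻¹ v`, then `𝔞` carries the FULL exponent of `Q` at `v`: `ord_v 𝔞 = ord_v Q`.
[cite: Shimura1998, §13.1 Thm. 1 (pp. 97–99)] -/
theorem count_eq_count_of_mul_pointwise_smul_eq_of_not_le (c : G) {𝔞 Q : Ideal B} (hQ : Q ≠ ⊥) (h : 𝔞 * c • 𝔞 = Q)
    {v : HeightOneSpectrum B} (hv : ¬ 𝔞 ≤ (c⁻¹ • v).asIdeal) :
    (Associates.mk v.asIdeal).count (Associates.mk 𝔞).factors = (Associates.mk v.asIdeal).count (Associates.mk Q).factors := by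
  have h0 := count_eq_zero_of_not_le (ne_bot_of_mul_pointwise_smul_eq c hQ h) hv
  have := count_add_count_inv_smul_eq c hQ h v
  omega

/-- **THE SUPPORT PIN** — if `𝔞 · (c • 𝔞) = Q ≠ 0` and `𝔞` AVOIDS a set `E` of primes which meets every pair `{v, c⁻¹ v}` of primes
over `Q` (`Q ⊆ 𝔭_v`, `v ∉ E ⇒ c⁻¹ v ∈ E`), then the exponents of `𝔞` are forced: `ord_v 𝔞 = 0` on `E` and `ord_v 𝔞 = ord_v Q` off `E`
(at primes not over `Q` both sides vanish).  The arithmetic skeleton of [Shimura1998] §13.1 Thm. 1: an integral ideal of norm-ideal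
`(q)` is determined by the primes over `p` it avoids. [cite: Shimura1998, §13.1 Thm. 1 (pp. 97–99)] -/
theorem count_eq_ite_of_mul_pointwise_smul_eq (c : G) {𝔞 Q : Ideal B} (hQ : Q ≠ ⊥) (h : 𝔞 * c • 𝔞 = Q)
    {E : Set (HeightOneSpectrum B)} [DecidablePred (· ∈ E)] (havoid : ∀ v ∈ E, ¬ 𝔞 ≤ v.asIdeal)
    (hE : ∀ v : HeightOneSpectrum B, Q ≤ v.asIdeal → v ∉ E → c⁻¹ • v ∈ E) (v : HeightOneSpectrum B) :
    (Associates.mk v.asIdeal).count (Associates.mk 𝔞).factors =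
      if v ∈ E then 0 else (Associates.mk v.asIdeal).count (Associates.mk Q).factors := by
  have h𝔞 : 𝔞 ≠ ⊥ := ne_bot_of_mul_pointwise_smul_eq c hQ h
  split_ifs with hv
  · exact count_eq_zero_of_not_le h𝔞 (havoid v hv)
  · by_cases hQv : Q ≤ v.asIdeal
    · exact count_eq_count_of_mul_pointwise_smul_eq_of_not_le c hQ h (havoid _ (hE v hQv hv))
    · have hQ0 := count_eq_zero_of_not_le hQ hQv
      have hle := count_le_of_mul_pointwise_smul_eq c hQ h v
      omega

/-- **UNIQUENESS UNDER THE SUPPORT PIN**: two ideals `𝔞`, `𝔟` with `𝔞 · (c • 𝔞) = Q = 𝔟 · (c • 𝔟)`, both avoiding a set `E` of primes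
meeting every pair `{v, c⁻¹ v}` over `Q`, are EQUAL. [cite: Shimura1998, §13.1 Thm. 1 (pp. 97–99)] -/
theorem eq_of_mul_pointwise_smul_eq_of_forall_not_le (c : G) {𝔞 𝔟 Q : Ideal B} (hQ : Q ≠ ⊥)
    (ha : 𝔞 * c • 𝔞 = Q) (hb : 𝔟 * c • 𝔟 = Q) {E : Set (HeightOneSpectrum B)}
    (haE : ∀ v ∈ E, ¬ 𝔞 ≤ v.asIdeal) (hbE : ∀ v ∈ E, ¬ 𝔟 ≤ v.asIdeal)
    (hE : ∀ v : HeightOneSpectrum B, Q ≤ v.asIdeal → v ∉ E → c⁻¹ • v ∈ E) : 𝔞 = 𝔟 := by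
  classical
  exact eq_of_forall_count_eq (ne_bot_of_mul_pointwise_smul_eq c hQ ha) (ne_bot_of_mul_pointwise_smul_eq c hQ hb) fun v => by
    rw [count_eq_ite_of_mul_pointwise_smul_eq c hQ ha haE hE v, count_eq_ite_of_mul_pointwise_smul_eq c hQ hb hbE hE v]

/-- **THE PRODUCT SHAPE UNDER THE SUPPORT PIN**: `𝔞 = ∏_{v ∉ E} 𝔭_v^{ord_v Q}` (as a finite product over the height-one spectrum,
`maxPowDividing` currency). [cite: Shimura1998, §13.1 Thm. 1 (pp. 97–99)] -/
theorem eq_finprod_of_mul_pointwise_smul_eq (c : G) {𝔞 Q : Ideal B} (hQ : Q ≠ ⊥) (h : 𝔞 * c • 𝔞 = Q)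
    {E : Set (HeightOneSpectrum B)} [DecidablePred (· ∈ E)] (havoid : ∀ v ∈ E, ¬ 𝔞 ≤ v.asIdeal)
    (hE : ∀ v : HeightOneSpectrum B, Q ≤ v.asIdeal → v ∉ E → c⁻¹ • v ∈ E) :
    𝔞 = ∏ᶠ v : HeightOneSpectrum B, if v ∈ E then 1 else v.maxPowDividing Q := by
  have h𝔞 : 𝔞 ≠ ⊥ := ne_bot_of_mul_pointwise_smul_eq c hQ h
  conv_lhs => rw [← Ideal.finprod_heightOneSpectrum_factorization h𝔞]
  refine finprod_congr fun v => ?_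
  rw [HeightOneSpectrum.maxPowDividing, count_eq_ite_of_mul_pointwise_smul_eq c hQ h havoid hE v]
  split_ifs with hv
  · rw [pow_zero]
  · rfl

/-- A prime avoided by `𝔞` is COPRIME to it: `𝔞 ⊔ 𝔭_v = ⊤` (every nonzero prime of a Dedekind domain is maximal).
[cite: MilneANT2008, Def. 3.3 (p. 41)] -/
theorem sup_eq_top_of_not_le {𝔞 : Ideal B} {v : HeightOneSpectrum B} (hv : ¬ 𝔞 ≤ v.asIdeal) : 𝔞 ⊔ v.asIdeal = ⊤ := by
  refine v.isMaximal.1.2 _ (lt_of_le_of_ne le_sup_right fun h => hv ?_)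
  rw [h]
  exact le_sup_left

end Dedekind

/-! ### §2 The CM specialisation: `c` = complex conjugation, `Q = (n)` — the token shape of the twist-norm law `(n) = 𝔞 · c𝔞` -/

section CM

variable {F : Type*} [Field F] [NumberField F] [IsCMField F]

/-- Complex conjugation is an involution of the CM field: `c⁻¹ = c` in `F ≃ₐ[F⁺] F` (same statement as the Summits-side
`Theorems/F0P6aKottwitzCountAtSplitPlace.complexConj_inv`, which a Literature file cannot import). [cite: Shimura1998, §13.1 Thm. 1 (pp. 97–99)] -/
theorem complexConj_inv : (IsCMField.complexConj F)⁻¹ = IsCMField.complexConj F :=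
  inv_eq_of_mul_eq_one_right (by ext x; simp [AlgEquiv.mul_apply])

/-- `c⁻¹ • v = c • v` on the finite places. [cite: Shimura1998, §13.1 Thm. 1 (pp. 97–99)] -/
theorem complexConj_inv_smul (v : HeightOneSpectrum (𝓞 F)) :
    (IsCMField.complexConj F)⁻¹ • v = (IsCMField.complexConj F) • v := by
  rw [complexConj_inv]

/-- `c • (c • v) = v` on the finite places. [cite: Shimura1998, §13.1 Thm. 1 (pp. 97–99)] -/
theorem complexConj_smul_complexConj_smul (v : HeightOneSpectrum (𝓞 F)) :
    (IsCMField.complexConj F) • ((IsCMField.complexConj F) • v) = v := by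
  nth_rewrite 1 [← complexConj_inv (F := F)]
  exact inv_smul_smul _ _

omit [IsCMField F] in
/-- The principal ideal of a nonzero natural number is nonzero in `𝓞 F` (characteristic `0`). [cite: MilneANT2008, Thm. 3.7 (p. 42)] -/
theorem span_natCast_ne_bot {n : ℕ} (hn : n ≠ 0) : (Ideal.span {((n : ℕ) : 𝓞 F)} : Ideal (𝓞 F)) ≠ ⊥ := by
  rw [Ne, Ideal.span_singleton_eq_bot]
  exact Nat.cast_ne_zero.mpr hn

/-- If `(n) = 𝔞 · c𝔞` with `n ≠ 0` then `𝔞 ≠ 0`. [cite: Shimura1998, §13.1 Thm. 1 (pp. 97–99)] -/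
theorem ne_bot_of_span_eq_mul_complexConj_smul {𝔞 : Ideal (𝓞 F)} {n : ℕ} (hn : n ≠ 0)
    (h : Ideal.span {((n : ℕ) : 𝓞 F)} = 𝔞 * (IsCMField.complexConj F) • 𝔞) : 𝔞 ≠ ⊥ :=
  ne_bot_of_mul_pointwise_smul_eq (IsCMField.complexConj F) (span_natCast_ne_bot hn) h.symm

/-- **THE TWIST-NORM LAW PRIME BY PRIME**: `(n) = 𝔞 · c𝔞` gives `ord_v 𝔞 + ord_{c v} 𝔞 = ord_v (n)` at every finite place `v` of the
CM field. [cite: Shimura1998, §13.1 Thm. 1 (pp. 97–99)] -/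
theorem count_add_count_complexConj_smul_eq {𝔞 : Ideal (𝓞 F)} {n : ℕ} (hn : n ≠ 0)
    (h : Ideal.span {((n : ℕ) : 𝓞 F)} = 𝔞 * (IsCMField.complexConj F) • 𝔞) (v : HeightOneSpectrum (𝓞 F)) :
    (Associates.mk v.asIdeal).count (Associates.mk 𝔞).factors +
        (Associates.mk ((IsCMField.complexConj F) • v).asIdeal).count (Associates.mk 𝔞).factors =
      (Associates.mk v.asIdeal).count (Associates.mk (Ideal.span {((n : ℕ) : 𝓞 F)})).factors := by
  rw [← complexConj_inv_smul]
  exact count_add_count_inv_smul_eq (IsCMField.complexConj F) (span_natCast_ne_bot hn) h.symm v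

/-- **THE `w`-BLOCK PIN**: if `(n) = 𝔞 · c𝔞` and `𝔞` avoids the conjugate place `c • w` (`𝔞 ⊄ 𝔭_{c w}`), then `𝔞` carries the FULL
exponent of `(n)` at `w`: `ord_w 𝔞 = ord_w (n)` — the `w`-part `𝔭_w^{e_w f}` of the Frobenius twist ideal when `n = p^f`.
[cite: Shimura1998, §13.1 Thm. 1 (pp. 97–99)] -/
theorem count_eq_count_span_of_not_le_complexConj_smul {𝔞 : Ideal (𝓞 F)} {n : ℕ} (hn : n ≠ 0)
    (h : Ideal.span {((n : ℕ) : 𝓞 F)} = 𝔞 * (IsCMField.complexConj F) • 𝔞) {w : HeightOneSpectrum (𝓞 F)}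
    (hw : ¬ 𝔞 ≤ ((IsCMField.complexConj F) • w).asIdeal) :
    (Associates.mk w.asIdeal).count (Associates.mk 𝔞).factors =
      (Associates.mk w.asIdeal).count (Associates.mk (Ideal.span {((n : ℕ) : 𝓞 F)})).factors :=
  count_eq_count_of_mul_pointwise_smul_eq_of_not_le (IsCMField.complexConj F) (span_natCast_ne_bot hn) h.symm
    (by rwa [complexConj_inv_smul])

/-- The divisibility form of the `w`-block pin: `𝔭_w^{ord_w (n)} ∣ 𝔞`. [cite: Shimura1998, §13.1 Thm. 1 (pp. 97–99)] -/
theorem pow_count_span_dvd_of_not_le_complexConj_smul {𝔞 : Ideal (𝓞 F)} {n : ℕ} (hn : n ≠ 0)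
    (h : Ideal.span {((n : ℕ) : 𝓞 F)} = 𝔞 * (IsCMField.complexConj F) • 𝔞) {w : HeightOneSpectrum (𝓞 F)}
    (hw : ¬ 𝔞 ≤ ((IsCMField.complexConj F) • w).asIdeal) :
    w.asIdeal ^ (Associates.mk w.asIdeal).count (Associates.mk (Ideal.span {((n : ℕ) : 𝓞 F)})).factors ∣ 𝔞 := by
  rw [pow_dvd_iff_le_count w (ne_bot_of_span_eq_mul_complexConj_smul hn h),
    count_eq_count_span_of_not_le_complexConj_smul hn h hw]

/-- The mirror reading: if `𝔞` avoids `w` itself then the conjugate place carries the full exponent, `ord_{c w} 𝔞 = ord_w (n)`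
(`ord_{c w} (n) = ord_w (n)` as `c` fixes `(n)`). [cite: Shimura1998, §13.1 Thm. 1 (pp. 97–99)] -/
theorem count_complexConj_smul_eq_count_span_of_not_le {𝔞 : Ideal (𝓞 F)} {n : ℕ} (hn : n ≠ 0)
    (h : Ideal.span {((n : ℕ) : 𝓞 F)} = 𝔞 * (IsCMField.complexConj F) • 𝔞) {w : HeightOneSpectrum (𝓞 F)}
    (hw : ¬ 𝔞 ≤ w.asIdeal) :
    (Associates.mk ((IsCMField.complexConj F) • w).asIdeal).count (Associates.mk 𝔞).factors =
      (Associates.mk w.asIdeal).count (Associates.mk (Ideal.span {((n : ℕ) : 𝓞 F)})).factors := by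
  have h0 := count_eq_zero_of_not_le (ne_bot_of_span_eq_mul_complexConj_smul hn h) hw
  have := count_add_count_complexConj_smul_eq hn h w
  omega

/-- **THE SUPPORT PIN, CM FORM**: if `(n) = 𝔞 · c𝔞` (`n ≠ 0`) and `𝔞` avoids a set `E` of finite places such that every place
`v ∋ n` outside `E` has `c • v ∈ E`, then `ord_v 𝔞 = 0` on `E` and `ord_v 𝔞 = ord_v (n)` off `E`.  With `E` = «`c • w` and the
places over `p` of étale type» this is the statement that the booked support law FORCES the Shimura–Taniyama shape of the twist
ideal. [cite: Shimura1998, §13.1 Thm. 1 (pp. 97–99)] -/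
theorem count_eq_ite_of_span_eq_mul_complexConj_smul {𝔞 : Ideal (𝓞 F)} {n : ℕ} (hn : n ≠ 0)
    (h : Ideal.span {((n : ℕ) : 𝓞 F)} = 𝔞 * (IsCMField.complexConj F) • 𝔞)
    {E : Set (HeightOneSpectrum (𝓞 F))} [DecidablePred (· ∈ E)] (havoid : ∀ v ∈ E, ¬ 𝔞 ≤ v.asIdeal)
    (hE : ∀ v : HeightOneSpectrum (𝓞 F), ((n : ℕ) : 𝓞 F) ∈ v.asIdeal → v ∉ E → (IsCMField.complexConj F) • v ∈ E)
    (v : HeightOneSpectrum (𝓞 F)) :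
    (Associates.mk v.asIdeal).count (Associates.mk 𝔞).factors =
      if v ∈ E then 0 else (Associates.mk v.asIdeal).count (Associates.mk (Ideal.span {((n : ℕ) : 𝓞 F)})).factors :=
  count_eq_ite_of_mul_pointwise_smul_eq (IsCMField.complexConj F) (span_natCast_ne_bot hn) h.symm havoid
    (fun v hv hvE => by
      rw [complexConj_inv_smul]
      exact hE v ((Ideal.span_singleton_le_iff_mem _).mp hv) hvE) v

/-- **UNIQUENESS OF THE TWIST IDEAL UNDER THE SUPPORT LAW**: two ideals with `(n) = 𝔞 · c𝔞 = 𝔟 · c𝔟`, both avoiding a set `E`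
of places meeting every pair `{v, c v}` over `n`, coincide. [cite: Shimura1998, §13.1 Thm. 1 (pp. 97–99)] -/
theorem eq_of_span_eq_mul_complexConj_smul {𝔞 𝔟 : Ideal (𝓞 F)} {n : ℕ} (hn : n ≠ 0)
    (ha : Ideal.span {((n : ℕ) : 𝓞 F)} = 𝔞 * (IsCMField.complexConj F) • 𝔞)
    (hb : Ideal.span {((n : ℕ) : 𝓞 F)} = 𝔟 * (IsCMField.complexConj F) • 𝔟)
    {E : Set (HeightOneSpectrum (𝓞 F))} (haE : ∀ v ∈ E, ¬ 𝔞 ≤ v.asIdeal) (hbE : ∀ v ∈ E, ¬ 𝔟 ≤ v.asIdeal)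
    (hE : ∀ v : HeightOneSpectrum (𝓞 F), ((n : ℕ) : 𝓞 F) ∈ v.asIdeal → v ∉ E → (IsCMField.complexConj F) • v ∈ E) :
    𝔞 = 𝔟 :=
  eq_of_mul_pointwise_smul_eq_of_forall_not_le (IsCMField.complexConj F) (span_natCast_ne_bot hn) ha.symm hb.symm haE hbE
    (fun v hv hvE => by
      rw [complexConj_inv_smul]
      exact hE v ((Ideal.span_singleton_le_iff_mem _).mp hv) hvE)

/-- **THE PRODUCT SHAPE, CM FORM**: under the support law, `𝔞 = ∏_{v ∉ E} 𝔭_v^{ord_v (n)}`. [cite: Shimura1998, §13.1 Thm. 1 (pp. 97–99)] -/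
theorem eq_finprod_of_span_eq_mul_complexConj_smul {𝔞 : Ideal (𝓞 F)} {n : ℕ} (hn : n ≠ 0)
    (h : Ideal.span {((n : ℕ) : 𝓞 F)} = 𝔞 * (IsCMField.complexConj F) • 𝔞)
    {E : Set (HeightOneSpectrum (𝓞 F))} [DecidablePred (· ∈ E)] (havoid : ∀ v ∈ E, ¬ 𝔞 ≤ v.asIdeal)
    (hE : ∀ v : HeightOneSpectrum (𝓞 F), ((n : ℕ) : 𝓞 F) ∈ v.asIdeal → v ∉ E → (IsCMField.complexConj F) • v ∈ E) :
    𝔞 = ∏ᶠ v : HeightOneSpectrum (𝓞 F), if v ∈ E then 1 else v.maxPowDividing (Ideal.span {((n : ℕ) : 𝓞 F)}) :=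
  eq_finprod_of_mul_pointwise_smul_eq (IsCMField.complexConj F) (span_natCast_ne_bot hn) h.symm havoid
    (fun v hv hvE => by
      rw [complexConj_inv_smul]
      exact hE v ((Ideal.span_singleton_le_iff_mem _).mp hv) hvE)

omit [IsCMField F] in
/-- The exponent of a place in `(p^f)` is `f` times its exponent in `(p)` (`= e_v · f` at `v ∣ p`; exponents add under products).
[cite: MilneANT2008, Thm. 3.7 (p. 42)] -/
theorem count_span_natCast_pow (p f : ℕ) (hp : p ≠ 0) (v : HeightOneSpectrum (𝓞 F)) :
    (Associates.mk v.asIdeal).count (Associates.mk (Ideal.span {((p ^ f : ℕ) : 𝓞 F)})).factors =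
      f * (Associates.mk v.asIdeal).count (Associates.mk (Ideal.span {((p : ℕ) : 𝓞 F)})).factors := by
  rw [Nat.cast_pow, ← Ideal.span_singleton_pow, Associates.mk_pow,
    Associates.count_pow (Associates.mk_ne_zero.mpr (span_natCast_ne_bot hp)) v.associates_irreducible]

/-! ### §3 (ED. 2, append-only) The `w`-block pin in COPRIMALITY form — the binder shape of the L3 closer `stub_ROOF0` (`(π1) 𝔞 ⊔ 𝔭_{c•w} = ⊤`) -/

omit [NumberField F] [IsCMField F] in
/-- Coprimality to a proper ideal excludes containment: `𝔞 ⊔ 𝔭 = ⊤`, `𝔭 ≠ ⊤` ⇒ `𝔞 ⊄ 𝔭`. [cite: MilneANT2008, Def. 3.3 (p. 41)] -/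
theorem not_le_of_sup_eq_top {𝔞 𝔭 : Ideal (𝓞 F)} (h : 𝔞 ⊔ 𝔭 = ⊤) (h𝔭 : 𝔭 ≠ ⊤) : ¬ 𝔞 ≤ 𝔭 :=
  fun hle => h𝔭 (by rwa [sup_eq_right.2 hle] at h)

/-- **THE `w`-BLOCK PIN, COPRIMALITY FORM**: `(n) = 𝔞 · c𝔞`, `n ≠ 0`, `𝔞 ⊔ 𝔭_{c•w} = ⊤` ⇒ `ord_w 𝔞 = ord_w (n)` — the binders `_hspec`, `(_hpin …).1` of the
L3 closer `stub_ROOF0` (skeleton v4b) read directly; with `n = p^f` and `count_span_natCast_pow` this is `ord_w 𝔞 = f · ord_w (p) = e_w f`.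
[cite: Shimura1998, §13.1 Thm. 1 (pp. 97–99)] -/
theorem count_eq_count_span_of_sup_complexConj_smul_eq_top {𝔞 : Ideal (𝓞 F)} {n : ℕ} (hn : n ≠ 0)
    (h : Ideal.span {((n : ℕ) : 𝓞 F)} = 𝔞 * (IsCMField.complexConj F) • 𝔞) {w : HeightOneSpectrum (𝓞 F)}
    (hw : 𝔞 ⊔ ((IsCMField.complexConj F) • w).asIdeal = ⊤) :
    (Associates.mk w.asIdeal).count (Associates.mk 𝔞).factors =
      (Associates.mk w.asIdeal).count (Associates.mk (Ideal.span {((n : ℕ) : 𝓞 F)})).factors :=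
  count_eq_count_span_of_not_le_complexConj_smul hn h (not_le_of_sup_eq_top hw ((IsCMField.complexConj F) • w).isMaximal.ne_top)

/-- The divisibility form: `(n) = 𝔞 · c𝔞`, `𝔞 ⊔ 𝔭_{c•w} = ⊤` ⇒ `𝔭_w^{ord_w (n)} ∣ 𝔞`. [cite: Shimura1998, §13.1 Thm. 1 (pp. 97–99)] -/
theorem pow_count_span_dvd_of_sup_complexConj_smul_eq_top {𝔞 : Ideal (𝓞 F)} {n : ℕ} (hn : n ≠ 0)
    (h : Ideal.span {((n : ℕ) : 𝓞 F)} = 𝔞 * (IsCMField.complexConj F) • 𝔞) {w : HeightOneSpectrum (𝓞 F)}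
    (hw : 𝔞 ⊔ ((IsCMField.complexConj F) • w).asIdeal = ⊤) :
    w.asIdeal ^ (Associates.mk w.asIdeal).count (Associates.mk (Ideal.span {((n : ℕ) : 𝓞 F)})).factors ∣ 𝔞 :=
  pow_count_span_dvd_of_not_le_complexConj_smul hn h (not_le_of_sup_eq_top hw ((IsCMField.complexConj F) • w).isMaximal.ne_top)

/-- The exactness form: `(n) = 𝔞 · c𝔞`, `𝔞 ⊔ 𝔭_{c•w} = ⊤` ⇒ `𝔭_w^{ord_w (n) + 1} ∤ 𝔞` (so `𝔭_w^{ord_w (n)} ∥ 𝔞`). [cite: Shimura1998, §13.1 Thm. 1 (pp. 97–99)] -/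
theorem not_pow_count_span_succ_dvd_of_sup_complexConj_smul_eq_top {𝔞 : Ideal (𝓞 F)} {n : ℕ} (hn : n ≠ 0)
    (h : Ideal.span {((n : ℕ) : 𝓞 F)} = 𝔞 * (IsCMField.complexConj F) • 𝔞) {w : HeightOneSpectrum (𝓞 F)}
    (hw : 𝔞 ⊔ ((IsCMField.complexConj F) • w).asIdeal = ⊤) :
    ¬ w.asIdeal ^ ((Associates.mk w.asIdeal).count (Associates.mk (Ideal.span {((n : ℕ) : 𝓞 F)})).factors + 1) ∣ 𝔞 := by
  rw [pow_dvd_iff_le_count w (ne_bot_of_span_eq_mul_complexConj_smul hn h), count_eq_count_span_of_sup_complexConj_smul_eq_top hn h hw]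
  omega

/-- The `c•w`-exponent in coprimality form: `𝔞 ⊔ 𝔭_{c•w} = ⊤`, `𝔞 ≠ 0` ⇒ `ord_{c•w} 𝔞 = 0`. [cite: Shimura1998, §13.1 Thm. 1 (pp. 97–99)] -/
theorem count_complexConj_smul_eq_zero_of_sup_eq_top {𝔞 : Ideal (𝓞 F)} (h𝔞 : 𝔞 ≠ ⊥) {w : HeightOneSpectrum (𝓞 F)}
    (hw : 𝔞 ⊔ ((IsCMField.complexConj F) • w).asIdeal = ⊤) :
    (Associates.mk ((IsCMField.complexConj F) • w).asIdeal).count (Associates.mk 𝔞).factors = 0 :=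
  count_eq_zero_of_not_le h𝔞 (not_le_of_sup_eq_top hw ((IsCMField.complexConj F) • w).isMaximal.ne_top)

end CM

end Literature.NumberTheory.NumberFields
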